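import Summits.CriticalPhenomena.CardyFormulaZ2.Theorems.CardyBoundaryCoulombGasHalfPlaneMarkDensityLawSelfDualityExact
import Literature.Probability.Percolation.Z2HalfPlaneThreeArm

/-!
# `HalfPlaneMarkDensityLaw` (crux stmt-CriticalPhenomena-5661), line `Sketch`, cycle 2 (gap closing):
# glue stub `stub_oneArm_of_notCross_of` — G1 and G3 give G4

The lattice half-plane is `H = ℤ × ℕ` (`halfPlane`), the source arc is `A = [α',−S]×{0}` and the
target arc is `C = [1,X]×{0}` (`rowIcc`), `0 ≤ S`, `1 ≤ X`, `α' ≤ −S`.  Write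
`L = {e | ∃ w ∈ e, w 0 < α'}` for the edges with an endpoint strictly left of the source arc and
`ω' = ω ∖ L`.

Deterministic assembly: if `A ↮ C` inside `H` for `ω` and the set of sites joined inside `H` to `C`
is bounded, then

1. the joined set of `C` is bounded for `ω' ⊆ ω` as well (`openConnIn` is increasing,
   `isUpperSet_openConnIn`);
2. (hypothesis G1) `ω'` does not join the RAY `(−∞,−S]×{0}` to `C` inside `H`;
3. the tree's "at least one" lemma `SelfDual.dual_of_not_primal` applied to `ω'` yields a legged
   dual path of `(ω')*` inside `H` from a gap face `(b,0)`, `−S ≤ b ≤ 0`, to a face `(b',0)`,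
   `b' ≥ X`;
4. (hypothesis G3, truncation) with `R ≤ X ≤ b' − b` and `R ≤ −S − α' + 1 ≤ b − α' + 1` this path
   contains a closed arm of `ω` from the moat face `(b,−1)` to sup-distance `R` inside `faceBox b R`;
5. hence `ω ∈ Z2HalfPlane.oneArm (−S) (S.toNat + 1) R` (right disjunct, `a := b ∈ [−S, 1)`).
-/

noncomputable section

namespace Summit.CriticalPhenomena.CardyFormulaZ2.Cruxes.HalfPlaneMarkDensityLaw.SketchLine

open Literature.Probability.Percolation Literature.Probability.LatticeModels
open Literature.Probability.Percolation.Z2HalfPlane (leg Far faceBox oneArm)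
open MeasureTheory Filter Set SimpleGraph
open scoped Topology
open Summit.CriticalPhenomena.CardyFormulaZ2.Theorems.HalfPlaneMarkDensityLaw.Negative

namespace GapClose

/-- **Glue G4' (deterministic assembly).**  From G1 (closing the edges left of the source arc, a
configuration not joining `[α',−S]×{0}` to `[1,X]×{0}` inside `H` does not join the ray
`(−∞,−S]×{0}` to `[1,X]×{0}`) and G3 (truncation of a legged dual path of `(ω ∖ L)*` to a closed arm
of `ω` inside `faceBox b R`), together with the tree lemma `SelfDual.dual_of_not_primal`: not joining
the arcs (with bounded joined set of the target arc) forces one closed arm of `ω` from the moat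
under the gap window `[−S, 1)` to sup-distance `R`, i.e. `ω ∈ oneArm (−S) (S.toNat + 1) R`, whenever
`R ≤ X` and `R ≤ −S − α' + 1`. [folklore] -/
theorem stub_oneArm_of_notCross_of :
    (∀ (ω : BondConfig (Site 2)) (α' S X : ℤ), α' ≤ -S → -S < 1 → ω ∉ openCrossing halfPlane (rowIcc α' (-S)) (rowIcc 1 X) → ω \ {e | ∃ w ∈ e, w 0 < α'} ∉ openCrossing halfPlane {v : Site 2 | v 1 = 0 ∧ v 0 ≤ -S} (rowIcc 1 X)) →
    (∀ (ω : BondConfig (Site 2)) (α' b b' : ℤ) (R : ℕ), (R : ℤ) ≤ b' - b → (R : ℤ) ≤ b - α' + 1 → leg b ∈ dualConfig (ω \ {e | ∃ w ∈ e, w 0 < α'}) → dualConfig (ω \ {e | ∃ w ∈ e, w 0 < α'}) ∈ openConnIn halfPlane ![b, 0] ![b', 0] → ∃ g : Site 2, Far R b g ∧ dualConfig ω ∈ openConnIn ↑(faceBox b R) ![b, -1] g) →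
    ∀ (ω : BondConfig (Site 2)) (α' S X : ℤ) (R N : ℕ), α' ≤ -S → 0 ≤ S → 1 ≤ X → (∀ y : Site 2, (∃ r ∈ rowIcc 1 X, ω ∈ openConnIn halfPlane r y) → |y 0| ≤ N ∧ y 1 ≤ N) → ω ∉ openCrossing halfPlane (rowIcc α' (-S)) (rowIcc 1 X) → (R : ℤ) ≤ X → (R : ℤ) ≤ -S - α' + 1 → ω ∈ oneArm (-S) (S.toNat + 1) R := by
  intro hG1 hG3 ω α' S X R N hαS hS hX hN hE hRX hRα
  -- (1) the joined set of the target arc is bounded for the smaller configuration `ω ∖ L`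
  have hN' : ∀ y : Site 2, (∃ r ∈ rowIcc 1 X, ω \ {e | ∃ w ∈ e, w 0 < α'} ∈ openConnIn halfPlane r y) →
      |y 0| ≤ N ∧ y 1 ≤ N := by
    rintro y ⟨r, hr, h⟩
    exact hN y ⟨r, hr, isUpperSet_openConnIn halfPlane r y Set.sdiff_subset h⟩
  -- (2) `ω ∖ L` does not join the ray `(−∞,−S]×{0}` to the target arc
  have hE' : ω \ {e | ∃ w ∈ e, w 0 < α'} ∉
      openCrossing halfPlane {v : Site 2 | v 1 = 0 ∧ v 0 ≤ -S} (rowIcc 1 X) :=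
    hG1 ω α' S X hαS (by omega) hE
  -- (3) the legged dual path of `(ω ∖ L)*` from a gap face `(b,0)` to a face `(b',0)`, `b' ≥ X`
  obtain ⟨b, b', hSb, hb0, hXb', hlegb, -, hconn⟩ := SelfDual.dual_of_not_primal hS hX hN' hE'
  -- (4) truncation to a closed arm of `ω` inside `faceBox b R`
  obtain ⟨g, hfar, harm⟩ := hG3 ω α' b b' R (by omega) (by omega) hlegb hconn
  -- (5) the right disjunct of `oneArm` with `a := b`
  refine ⟨b, hSb, ?_, Or.inr ⟨g, hfar, harm⟩⟩
  have hSS : ((S.toNat : ℕ) : ℤ) = S := Int.toNat_of_nonneg hS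
  push_cast
  omega

end GapClose

end Summit.CriticalPhenomena.CardyFormulaZ2.Cruxes.HalfPlaneMarkDensityLaw.SketchLine
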